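import Mathlib.RingTheory.MvPowerSeries.Substitution
import Mathlib.RingTheory.MvPowerSeries.Order
import Mathlib.RingTheory.MvPowerSeries.Trunc
import Mathlib.RingTheory.PowerSeries.Order
import Mathlib.NumberTheory.Padics.PadicIntegers
import Mathlib.Combinatorics.Nullstellensatz
import Mathlib.Algebra.Order.Antidiag.Finsupp
import Mathlib.Algebra.Ring.GeomSum
import HarnessLib

/-!
# Crux `PlecticRankUB` (stmt-BirchSwinnertonDyer-17519), line
# `heegner-leading-form-plectic-certificate` — stub P2 `stub_genericLine`: generic line order

Registered stub P2 of the skeleton of line `heegner-leading-form-plectic-certificate` (route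
`PlecticLegs`, crux #3,
`Summit.BirchSwinnertonDyer.BirchSwinnertonDyer.Theses.PlecticLegs.PlecticRankUB`): a lemma of
pure commutative algebra about power series in finitely many variables over `ℤ_p` (GENERIC LINE
ORDER). For a nonzero `g ∈ ℤ_p⟦T₁, …, T_n⟧` of total order `ν = MvPowerSeries.order g` and a
nonzero polynomial `h ∈ ℤ_p[T₁, …, T_n]` there is an integral direction `a ∈ ℕ^n` with every `aᵢ`
prime to `p` and `h(a) ≠ 0` along which the restriction of `g` to the line of direction `a`,
`g((1+T)^{a₁} − 1, …, (1+T)^{a_n} − 1) ∈ ℤ_p⟦T⟧` (Mathlib's `MvPowerSeries.subst`; the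
substituted series have zero constant term), has `T`-order exactly `ν`. In the composition of the
line this turns `2 · ord_T (g|_a)` into `2 · ord g`.

## Proof

Each substituted series is `(1+T)^c − 1 = T · u_c` with `u_c = Σ_{j<c} (1+T)^j`, `u_c(0) = c`
(`mul_geom_sum`). Hence the monomial `T^d` restricts to `T^{|d|} · Πᵢ u_{aᵢ}^{dᵢ}`
(`coeff_finsuppProd_pow_of_eq_X_mul`), so for `k ≤ ν` the coefficient of `T^k` of the
restriction is `Σ_{|d| = k} g_d · Πᵢ aᵢ^{dᵢ}` (`coeff_subst_of_eq_X_mul`, from Mathlib's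
`MvPowerSeries.coeff_subst`): it vanishes for `k < ν` and equals `g_ν(a)` for `k = ν`, where
`g_ν = MvPowerSeries.truncFinset ℤ_p (univ.finsuppAntidiag ν) g ≠ 0` is the leading form of `g`
(`order_subst_line_eq`). Finally `g_ν · h ≠ 0` (`ℤ_p` is a domain) does not vanish identically
on the grid `{1, 1+p, …, 1+Dp}^n`, `D = deg (g_ν h)` (Alon's combinatorial Nullstellensatz,
Mathlib's `MvPolynomial.eq_zero_of_eval_zero_at_prod_finset`; the points `1 + kp` are distinct
in `ℤ_p` by characteristic zero), which produces `a` with `aᵢ ≡ 1 (mod p)`, `h(a) ≠ 0` and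
`g_ν(a) ≠ 0`.

## References

* Folklore (leading forms of power series restricted to generic lines); the grid lemma is
  N. Alon, *Combinatorial Nullstellensatz*, Combin. Probab. Comput. 8 (1999), Lemma 2.1, in the
  form of Mathlib's `MvPolynomial.eq_zero_of_eval_zero_at_prod_finset`.
-/

-- `Summit.BirchSwinnertonDyer.BirchSwinnertonDyer` is the mandated summit-side namespace
-- (CONVENTIONS §2); the duplicate component is deliberate.
set_option linter.dupNamespace false

noncomputable section

open PowerSeries

namespace Summit.BirchSwinnertonDyer.BirchSwinnertonDyer.Theorems

/-- **A monomial along a line.** If `sᵢ = T · uᵢ ∈ R⟦T⟧` then for `d : σ →₀ ℕ` the product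
`Πᵢ sᵢ^{dᵢ} = T^{|d|} · Πᵢ uᵢ^{dᵢ}`, so its coefficient of `T^k` vanishes for `k < |d|` and is the
coefficient of `T^{k − |d|}` of `Πᵢ uᵢ^{dᵢ}` for `|d| ≤ k`. [folklore] -/
private theorem coeff_finsuppProd_pow_of_eq_X_mul {R : Type*} [CommRing R] {σ : Type*}
    {s u : σ → R⟦X⟧} (hsu : ∀ i, s i = X * u i) (d : σ →₀ ℕ) (k : ℕ) :
    PowerSeries.coeff k (d.prod fun i e => s i ^ e) =
      if d.degree ≤ k then PowerSeries.coeff (k - d.degree) (d.prod fun i e => u i ^ e)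
      else 0 := by
  have hprod : (d.prod fun i e => s i ^ e) = X ^ d.degree * d.prod fun i e => u i ^ e := by
    rw [Finsupp.prod, Finsupp.prod, Finsupp.degree_apply]
    simp_rw [hsu, mul_pow]
    rw [Finset.prod_mul_distrib, Finset.prod_pow_eq_pow_sum]
  rw [hprod, PowerSeries.coeff_X_pow_mul']

/-- **Coefficients along a line, up to the order.** Let `f ∈ R⟦σ⟧` (`σ` finite) have all
coefficients of total degree `< k` equal to zero and let `sᵢ = T · uᵢ ∈ R⟦T⟧`. Then the
coefficient of `T^k` of `f(s₁, …, s_σ)` (`MvPowerSeries.subst`) is the degree-`k` form of `f`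
evaluated at the constant terms of the `uᵢ`: `Σ_{|d| = k} f_d · Πᵢ uᵢ(0)^{dᵢ}` (the monomials of
degree `> k` only contribute from `T^{k+1}` on, `coeff_finsuppProd_pow_of_eq_X_mul`; Mathlib's
`MvPowerSeries.coeff_subst`). [folklore] -/
private theorem coeff_subst_of_eq_X_mul {R : Type*} [CommRing R] {σ : Type*} [Fintype σ]
    [DecidableEq σ] {s : σ → MvPowerSeries Unit R} {u : σ → R⟦X⟧} (hsu : ∀ i, s i = X * u i)
    (f : MvPowerSeries σ R) {k : ℕ}
    (hk : ∀ d : σ →₀ ℕ, d.degree < k → MvPowerSeries.coeff d f = 0) :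
    PowerSeries.coeff k (MvPowerSeries.subst s f) =
      ∑ d ∈ (Finset.univ : Finset σ).finsuppAntidiag k,
        MvPowerSeries.coeff d f * d.prod fun i e => PowerSeries.constantCoeff (u i) ^ e := by
  have hs : MvPowerSeries.HasSubst s :=
    MvPowerSeries.hasSubst_of_constantCoeff_zero fun i => by
      rw [hsu i]
      change PowerSeries.constantCoeff (X * u i) = 0
      simp
  rw [PowerSeries.coeff, MvPowerSeries.coeff_subst hs,
    finsum_eq_sum_of_support_subset _ (s := (Finset.univ : Finset σ).finsuppAntidiag k) ?_]
  · refine Finset.sum_congr rfl fun d hd => ?_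
    obtain ⟨hdk, -⟩ := Finset.mem_finsuppAntidiag.mp hd
    rw [← Finsupp.degree_eq_sum] at hdk
    rw [PowerSeries.coeff_coeToMvPowerSeries, coeff_finsuppProd_pow_of_eq_X_mul hsu,
      if_pos hdk.le, hdk, Nat.sub_self, PowerSeries.coeff_zero_eq_constantCoeff_apply,
      map_finsuppProd, smul_eq_mul]
    simp_rw [map_pow]
  · intro d hd
    rw [Function.mem_support] at hd
    rw [Finset.mem_coe, Finset.mem_finsuppAntidiag, ← Finsupp.degree_eq_sum]
    refine ⟨?_, Finset.subset_univ _⟩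
    by_contra hne
    rcases lt_or_gt_of_ne hne with hlt | hgt
    · exact hd (by rw [hk d hlt, zero_smul])
    · exact hd (by rw [PowerSeries.coeff_coeToMvPowerSeries,
        coeff_finsuppProd_pow_of_eq_X_mul hsu, if_neg (not_le.mpr hgt), smul_zero])

/-- **Order along a line through the leading form.** If `f ∈ R⟦σ⟧` has total order `N` and its
leading form `f_N = MvPowerSeries.truncFinset R (univ.finsuppAntidiag N) f` does not vanish at
`a ∈ ℕ^σ`, then `f((1+T)^{a₁} − 1, …) ∈ R⟦T⟧` has `T`-order exactly `N`: since
`(1+T)^c − 1 = T · Σ_{j<c} (1+T)^j` (`mul_geom_sum`) with cofactor of constant term `c`, the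
coefficients of `T^0, …, T^N` of the restriction are `0, …, 0, f_N(a)`
(`coeff_subst_of_eq_X_mul`). [folklore] -/
private theorem order_subst_line_eq {R : Type*} [CommRing R] {σ : Type*} [Fintype σ]
    [DecidableEq σ] (f : MvPowerSeries σ R) (a : σ → ℕ) {s : σ → MvPowerSeries Unit R}
    (hs : ∀ i, s i = ((1 + X : R⟦X⟧) ^ (a i) - 1 : R⟦X⟧)) {N : ℕ} (hN : f.order = N)
    (ha : MvPolynomial.eval (fun i => (a i : R))
      (MvPowerSeries.truncFinset R ((Finset.univ : Finset σ).finsuppAntidiag N) f) ≠ 0) :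
    PowerSeries.order (MvPowerSeries.subst s f) = N := by
  have hsu : ∀ i, s i = X * ∑ j ∈ Finset.range (a i), (1 + X : R⟦X⟧) ^ j := fun i => by
    rw [hs i, ← mul_geom_sum, add_sub_cancel_left]
  have hu : ∀ i, PowerSeries.constantCoeff (∑ j ∈ Finset.range (a i), (1 + X : R⟦X⟧) ^ j) =
      (a i : R) := fun i => by
    simp [map_sum]
  have hcoeff : ∀ k ≤ N, PowerSeries.coeff k (MvPowerSeries.subst s f) =
      ∑ d ∈ (Finset.univ : Finset σ).finsuppAntidiag k,
        MvPowerSeries.coeff d f * d.prod fun i e => (a i : R) ^ e := fun k hk => by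
    have hk' : ∀ d : σ →₀ ℕ, d.degree < k → MvPowerSeries.coeff d f = 0 := fun d hd =>
      MvPowerSeries.coeff_of_lt_order (by rw [hN]; exact_mod_cast hd.trans_le hk)
    rw [coeff_subst_of_eq_X_mul hsu f hk']
    simp_rw [hu]
  rw [PowerSeries.order_eq_nat]
  refine ⟨?_, fun k hk => ?_⟩
  · rw [hcoeff N le_rfl]
    convert ha using 1
    rw [MvPowerSeries.truncFinset_apply, map_sum]
    exact Finset.sum_congr rfl fun d _ => MvPolynomial.eval_monomial.symm
  · rw [hcoeff k hk.le]
    refine Finset.sum_eq_zero fun d hd => ?_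
    obtain ⟨hdk, -⟩ := Finset.mem_finsuppAntidiag.mp hd
    rw [← Finsupp.degree_eq_sum] at hdk
    rw [MvPowerSeries.coeff_of_lt_order (by rw [hN, hdk]; exact_mod_cast hk), zero_mul]

/-- Stub **P2** (`GenericLine`) of line `heegner-leading-form-plectic-certificate` for the crux
`PlecticRankUB`: **generic line order.** For a prime `p`, a nonzero `g ∈ ℤ_p⟦T₁, …, T_n⟧` and a
nonzero polynomial `h ∈ ℤ_p[T₁, …, T_n]` there is an integral direction `a : Fin n → ℕ` with every
`aᵢ` prime to `p`, `h(a) ≠ 0`, and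
`ord_T g((1+T)^{a₁} − 1, …, (1+T)^{a_n} − 1) = ord g` (the total order `ν`, the degree of the
leading form `g_ν`): the coefficient of `T^ν` of the restriction is `g_ν(a)` and the lower ones
vanish (`order_subst_line_eq`), and `g_ν · h ≠ 0` does not vanish identically on the grid
`{1, 1+p, 1+2p, …}^n` (Mathlib's `MvPolynomial.eq_zero_of_eval_zero_at_prod_finset`, `ℤ_p` a
domain of characteristic zero). [folklore] -/
theorem stub_genericLine :
    ∀ (p : ℕ) [Fact p.Prime] (n : ℕ) (g : MvPowerSeries (Fin n) ℤ_[p])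
      (h : MvPolynomial (Fin n) ℤ_[p]), g ≠ 0 → h ≠ 0 →
        ∃ a : Fin n → ℕ, (∀ i, ¬ p ∣ a i) ∧ MvPolynomial.eval (fun i => (a i : ℤ_[p])) h ≠ 0 ∧
          PowerSeries.order (MvPowerSeries.subst
            (fun i => (((1 + PowerSeries.X : PowerSeries ℤ_[p]) ^ (a i) - 1 : PowerSeries ℤ_[p]) :
              MvPowerSeries Unit ℤ_[p])) g) = MvPowerSeries.order g := by
  intro p hp n g h hg hh
  classical
  -- the total order `N` of `g` and its leading form `gN`
  obtain ⟨N, hN⟩ : ∃ N : ℕ, (N : ℕ∞) = g.order :=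
    ENat.ne_top_iff_exists.mp (mt MvPowerSeries.order_eq_top_iff.mp hg)
  obtain ⟨gN, hgN_eq⟩ : ∃ gN : MvPolynomial (Fin n) ℤ_[p],
      gN = MvPowerSeries.truncFinset ℤ_[p] ((Finset.univ : Finset (Fin n)).finsuppAntidiag N) g :=
    ⟨_, rfl⟩
  have hgN : gN ≠ 0 := by
    obtain ⟨⟨d, hd, hdN⟩, -⟩ := MvPowerSeries.order_eq_nat.mp hN.symm
    have hmem : d ∈ (Finset.univ : Finset (Fin n)).finsuppAntidiag N := by
      rw [Finset.mem_finsuppAntidiag, ← Finsupp.degree_eq_sum]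
      exact ⟨by exact_mod_cast hdN, Finset.subset_univ _⟩
    intro h0
    apply hd
    rw [← MvPowerSeries.coeff_truncFinset_of_mem g hmem, ← hgN_eq, h0, MvPolynomial.coeff_zero]
  -- `gN * h ≠ 0` does not vanish identically on the grid `{1, 1 + p, …, 1 + D p}^n`
  have hH : gN * h ≠ 0 := mul_ne_zero hgN hh
  have hinj : Function.Injective fun k : ℕ => ((1 + p * k : ℕ) : ℤ_[p]) := fun k l hkl =>
    Nat.eq_of_mul_eq_mul_left hp.out.pos (Nat.add_left_cancel (Nat.cast_injective hkl))
  obtain ⟨x, hxS, hx⟩ : ∃ x : Fin n → ℤ_[p],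
      (∀ i, x i ∈ (Finset.range ((gN * h).totalDegree + 1)).image
        fun k : ℕ => ((1 + p * k : ℕ) : ℤ_[p])) ∧ MvPolynomial.eval x (gN * h) ≠ 0 := by
    by_contra! hcon
    refine hH (MvPolynomial.eq_zero_of_eval_zero_at_prod_finset (gN * h) _ (fun i => ?_) hcon)
    rw [Finset.card_image_of_injective _ hinj, Finset.card_range]
    exact Nat.lt_succ_of_le (MvPolynomial.degreeOf_le_totalDegree _ i)
  -- read off the direction `aᵢ = 1 + p kᵢ`
  have hx' : ∀ i, ∃ k : ℕ, ((1 + p * k : ℕ) : ℤ_[p]) = x i := fun i => by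
    obtain ⟨k, -, hk⟩ := Finset.mem_image.mp (hxS i)
    exact ⟨k, hk⟩
  choose k hk using hx'
  obtain rfl : x = fun i => ((1 + p * k i : ℕ) : ℤ_[p]) := (funext hk).symm
  rw [map_mul] at hx
  refine ⟨fun i => 1 + p * k i, fun i => ?_, (mul_ne_zero_iff.mp hx).2, ?_⟩
  · -- `p ∣ 1 + p k` would force `p ∣ 1`
    rw [Nat.dvd_add_left (dvd_mul_right p (k i))]
    exact hp.out.not_dvd_one
  · rw [← hN]
    exact order_subst_line_eq g (fun i => 1 + p * k i) (fun _ => rfl) hN.symm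
      (hgN_eq ▸ (mul_ne_zero_iff.mp hx).1)

/-- **Order along a line through the leading form (public form of `order_subst_line_eq`).**
If `f ∈ R⟦σ⟧` (`σ` finite) has total order `N` and its leading form
`f_N = MvPowerSeries.truncFinset R (univ.finsuppAntidiag N) f` does not vanish at the integral
direction `a ∈ ℕ^σ`, then the restriction `f((1+T)^{a₁} − 1, …, (1+T)^{a_σ} − 1) ∈ R⟦T⟧` has
`T`-order exactly `N`. This is the pointwise content of GENERIC LINE: the exceptional directions of
a class `g` for the line order are contained in the hypersurface `{g_ν = 0}` of its leading form
(used by the lead's `genericBound_of_boundingClass`, line `heegner-leading-form-plectic-certificate`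
of crux `PlecticRankUB`, where it is a registered stub with this exact header). [folklore] -/
theorem order_lineSubst_eq_of_eval_leadingForm_ne_zero :
    ∀ (R : Type) [CommRing R] (n : ℕ) (f : MvPowerSeries (Fin n) R) (a : Fin n → ℕ) (N : ℕ),
      f.order = N →
      MvPolynomial.eval (fun i => (a i : R))
        (MvPowerSeries.truncFinset R ((Finset.univ : Finset (Fin n)).finsuppAntidiag N) f) ≠ 0 →
        PowerSeries.order (MvPowerSeries.subst
          (fun i => (((1 + PowerSeries.X : PowerSeries R) ^ (a i) - 1 : PowerSeries R) :
            MvPowerSeries Unit R)) f) = N :=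
  fun _ _ _ f a _ hN ha => order_subst_line_eq f a (fun _ => rfl) hN ha

end Summit.BirchSwinnertonDyer.BirchSwinnertonDyer.Theorems

end
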